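import Summits.ValiantsHypothesis.ValiantsHypothesis.Theorems.LacunarySymmetroidMatrixDescartesCensusKLawBridge
import Summits.ValiantsHypothesis.ValiantsHypothesis.Theorems.LacunarySymmetroidMatrixDescartesCensusFrame
import Summits.ValiantsHypothesis.ValiantsHypothesis.Theorems.LacunarySymmetroidMatrixDescartesCensusSignSplitInconsistent
import Summits.ValiantsHypothesis.ValiantsHypothesis.Theorems.LacunarySymmetroidMatrixDescartesCensusTropicalKLawBridges

/-!
# Census records for crux `MatrixDescartes` (stmt-18050): no split SKELETON law modulo T8, and the linear letter law shape

Two typed law SHAPES with their kernel relations to Conjecture B (`KPlusLogSqLaw`); nothing is asserted about B,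
`MatrixDescartes` or `VP ≠ VNP` (a law candidate does not move `VP ≠ VNP`).  Ideator val-idea-1 (D-0148 (a)), 2026-08-28.

1. `SplitSkeletonLawAt m K'` — "a split-class pencil `Σ_l σ_l X^{e_l} A_l` (`A_l ⪰ 0`, `e` strictly increasing) has
   at most `m · V(σ)` positive roots" (the commuting / tropically-generic SKELETON value; `V` = sign changes of the
   sign word).  Modulo the two T8 statements of line `sign_split` (`SplitToSemidefinite`, `PerturbToAlternation`,
   tree names) such a law at ALL formats gives the polynomial row `Z₊(m,K) ≤ 2·m·(2K−1)` for every symmetric pencil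
   (`posLaw_of_splitSkeletonLaw`), which the doubled kernel staircase refutes (`not_splitSkeletonLaw_of_T8`, via
   `Census.noGo_bilinearLogLaw`).  Located companion (not kernel): at `(m,K') = (2,6)`, one negative letter
   (`V = 2`), an exact rational certificate with `6 > 4` positive roots exists (ideator folder
   `scratch/p159188_split_exact.py`), so the skeleton law already fails at a single thin format.
2. `LinearLetterLaw` — "`Z₊(m,K) ≤ (K+1) · 2^{C log₂² m}`": linear in the number of letters, quasi-polynomial in the
   size.  It implies B (`kPlusLogSqLaw_of_linearLetterLaw`, constant `C + 3`) and is consistent with every kernel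
   family of record (diagonal `m(K−1)`, rails `mK + c`, towers at fixed `K`, CMS grafts, and the doubled staircase:
   `n^L ≤ 2^{log₂² m}` because `log₂ m ≥ L + log₂ n`); at `m = 2` it contradicts the cell's thin conjecture (T)
   (`ζ(2,K) = C(K+1,2) − 1`) for large `K` — the first deciding register is `ζ(2,6) ∈ {18, 19, 20}`.
0 sorry · standard axioms · no Cruxes import.
-/

set_option linter.dupNamespace false
set_option linter.unusedVariables false

namespace Summit.ValiantsHypothesis.ValiantsHypothesis.Theorems.LacunarySymmetroidMatrixDescartes.Census.SplitSkeleton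

open Polynomial Matrix Finset
open scoped BigOperators
open Summit.ValiantsHypothesis.ValiantsHypothesis.Theorems.MatrixDescartes.Negative (PosRootLawAt)
open Summit.ValiantsHypothesis.ValiantsHypothesis.Theorems.LacunarySymmetroidMatrixDescartes.Census.SignSplit
  (pencil posRootCount signed signChanges signChanges_le Alternates SplitToSemidefinite PerturbToAlternation)

/-- **Split skeleton law at format `(m, K')`** (a law SHAPE, never asserted): every split-class pencil
`Σ_l σ_l X^{e_l} A_l` with `A_l ⪰ 0` and strictly increasing `e` has at most `m · V(σ)` distinct positive roots of its
determinant, `V(σ)` = number of sign changes of the sign word — the skeleton value (commuting optimum; the generic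
tropical count of line `lorentzian-shadow`). [ideator val-idea-1; shape record] -/
def SplitSkeletonLawAt (m K' : ℕ) : Prop :=
  ∀ (e : Fin K' → ℕ) (σ : Fin K' → Bool) (A : Fin K' → Matrix (Fin m) (Fin m) ℝ),
    StrictMono e → (∀ l, (A l).PosSemidef) → posRootCount e (signed σ A) ≤ m * signChanges σ

/-- Modulo the two T8 statements of line `sign_split`, a split skeleton law at ALL formats gives the polynomial row
`Z₊(m,K) ≤ 2·m·(2K−1)` for every symmetric pencil (`V ≤ K' − 1 ≤ 2K − 2`). [this file] -/
theorem posLaw_of_splitSkeletonLaw (h₃ : SplitToSemidefinite) (h₂ : PerturbToAlternation)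
    (hsk : ∀ m K', SplitSkeletonLawAt m K') (m K : ℕ) : PosRootLawAt m K (2 * (m * (2 * K - 1))) := by
  intro d S hS
  show posRootCount d S ≤ _
  have hB : ∀ S' : Fin K → Matrix (Fin m) (Fin m) ℝ, (∀ l, (S' l).IsSymm) →
      ∀ (N : ℕ) (τ : Fin (N + 1) → ℝ), Alternates d S' N τ → N ≤ m * (2 * K - 1) := by
    intro S' hS' N τ hA
    obtain ⟨K', d', σ, A, hK', hd', hA', hN⟩ := h₃ K m d S' hS' N τ hA
    refine hN.trans ((hsk m K' d' σ A hd' hA').trans (Nat.mul_le_mul_left m ?_))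
    have := signChanges_le σ
    omega
  exact h₂ K m d (m * (2 * K - 1)) hB S hS

/-- **No split skeleton law at all formats (modulo T8)**: the polynomial row of `posLaw_of_splitSkeletonLaw` is below
the bilinear-in-logs budget `2^{4(log₂ m+1)(log₂ K+1)}`, which `Census.noGo_bilinearLogLaw` (doubled kernel staircase)
refutes. [this file + `Census.noGo_bilinearLogLaw`] -/
theorem not_splitSkeletonLaw_of_T8 (h₃ : SplitToSemidefinite) (h₂ : PerturbToAlternation) :
    ¬ ∀ m K', SplitSkeletonLawAt m K' := by
  intro hsk
  apply Census.noGo_bilinearLogLaw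
  refine ⟨4, fun m K d S hS => ((posLaw_of_splitSkeletonLaw h₃ h₂ hsk m K) d S hS).trans ?_⟩
  have hm : m < 2 ^ (Nat.log 2 m + 1) := Nat.lt_pow_succ_log_self (by norm_num) m
  have hK : K < 2 ^ (Nat.log 2 K + 1) := Nat.lt_pow_succ_log_self (by norm_num) K
  have h1 : 2 * (m * (2 * K - 1)) ≤ 2 ^ (Nat.log 2 m + 1) * 2 ^ (Nat.log 2 K + 1) * 4 := by
    have : 2 * K - 1 ≤ 2 * 2 ^ (Nat.log 2 K + 1) := by omega
    calc 2 * (m * (2 * K - 1)) ≤ 2 * (2 ^ (Nat.log 2 m + 1) * (2 * 2 ^ (Nat.log 2 K + 1))) :=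
          Nat.mul_le_mul_left 2 (Nat.mul_le_mul hm.le this)
      _ = 2 ^ (Nat.log 2 m + 1) * 2 ^ (Nat.log 2 K + 1) * 4 := by ring
  have h2 : 2 ^ (Nat.log 2 m + 1) * 2 ^ (Nat.log 2 K + 1) * 4 = 2 ^ (Nat.log 2 m + Nat.log 2 K + 4) := by
    rw [show (4 : ℕ) = 2 ^ 2 by norm_num, ← pow_add, ← pow_add]; ring_nf
  have h3 : Nat.log 2 m + Nat.log 2 K + 4 ≤ 4 * (Nat.log 2 m + 1) * (Nat.log 2 K + 1) := by
    nlinarith [Nat.zero_le (Nat.log 2 m), Nat.zero_le (Nat.log 2 K)]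
  calc 2 * (m * (2 * K - 1)) ≤ 2 ^ (Nat.log 2 m + Nat.log 2 K + 4) := h2 ▸ h1
    _ ≤ 2 ^ (4 * (Nat.log 2 m + 1) * (Nat.log 2 K + 1)) := Nat.pow_le_pow_right (by norm_num) h3

/-! ## The linear letter law shape -/

/-- **Linear letter law** (a law SHAPE, never asserted; the strongest shape consistent with every kernel family of
record as of 2026-08-28): `Z₊(m,K) ≤ (K+1) · 2^{C · log₂² m}` — every further letter costs O(1) roots times a
quasi-polynomial factor of the size.  Implies Conjecture B (`kPlusLogSqLaw_of_linearLetterLaw`); at `m = 2` it says the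
`(2,K)` column is linear in `K`, against the cell's thin conjecture (T). [ideator val-idea-1; shape record] -/
def LinearLetterLaw : Prop :=
  ∃ C : ℕ, ∀ m K : ℕ, PosRootLawAt m K ((K + 1) * 2 ^ (C * Nat.log 2 m ^ 2))

/-- **Linear letter law ⇒ Conjecture B** (constant `C + 3`: `K + 1 ≤ 2^K`, reflection transfer `2B+1`). [this file] -/
theorem kPlusLogSqLaw_of_linearLetterLaw (h : LinearLetterLaw) : KPlusLogSqLaw := by
  obtain ⟨C, hC⟩ := h
  refine ⟨C + 3, fun m K => ?_⟩
  rcases Nat.eq_zero_or_pos K with hK | hK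
  · subst hK
    exact TropicalCensus.realRootLawAt_zero m _
  set L : ℕ := Nat.log 2 m ^ 2 with hL
  have hreal := Census.realRootLawAt_of_posRootLawAt (hC m K)
  refine Census.realRootLawAt_mono ?_ hreal
  have hK1 : K + 1 ≤ 2 ^ K := Nat.lt_two_pow_self
  have h1 : (K + 1) * 2 ^ (C * L) ≤ 2 ^ (K + C * L) := by
    rw [pow_add]; exact Nat.mul_le_mul_right _ hK1
  have h2 : 2 * 2 ^ (K + C * L) + 1 ≤ 2 ^ (K + C * L + 2) := by
    have : 1 ≤ 2 ^ (K + C * L) := Nat.one_le_two_pow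
    calc 2 * 2 ^ (K + C * L) + 1 ≤ 2 ^ (K + C * L) * 4 := by omega
      _ = 2 ^ (K + C * L + 2) := by rw [pow_add _ (K + C * L) 2]; norm_num
  have h3 : K + C * L + 2 ≤ (C + 3) * (K + L) := by nlinarith [Nat.zero_le (C * K), Nat.zero_le L]
  calc 2 * ((K + 1) * 2 ^ (C * L)) + 1 ≤ 2 * 2 ^ (K + C * L) + 1 := by omega
    _ ≤ 2 ^ (K + C * L + 2) := h2
    _ ≤ 2 ^ ((C + 3) * (K + L)) := Nat.pow_le_pow_right (by norm_num) h3

/-- Hence the linear letter law implies the crux `MatrixDescartes` (tree bridge). [this file] -/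
theorem matrixDescartes_of_linearLetterLaw (h : LinearLetterLaw) :
    Summit.ValiantsHypothesis.ValiantsHypothesis.Theses.LacunarySymmetroid.MatrixDescartes :=
  Census.matrixDescartes_of_kPlusLogSqLaw (kPlusLogSqLaw_of_linearLetterLaw h)

end Summit.ValiantsHypothesis.ValiantsHypothesis.Theorems.LacunarySymmetroidMatrixDescartes.Census.SplitSkeleton
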